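import Literature.NumberTheory.EllipticCurves.IsogenyFromRationalMap
import HarnessLib

/-!
# Kernel-checked certificates for explicit isogeny formulae

Trunk T-ELLARITH; topic `NumberTheory/EllipticCurves`, notion `cm_endomorphisms_isogeny` (explicit
isogenies). The tree's `WeierstrassCurve.IsogenyFormula W₁ W₂`
(`Literature.NumberTheory.EllipticCurves.IsogenyFromRationalMap`) turns four polynomials
`U, h, S, T` describing a rational map `(x, y) ↦ (U(x)/h(x)², (S(x)·y + T(x))/h(x)³)` into an
isogeny `W₁ → W₂` (Silverman, *AEC*, Thm. III.4.8), *provided* two polynomial identities in `R[X]`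
(the equation of `W₂` pulls back to `S² ·` the equation of `W₁`) and a degree condition hold. For
an isogeny of prime degree `ℓ` the identities have degree `3ℓ`; for the CM isogenies of degree
`7, 11, 19, 43, 67, 163` needed by `Literature.NumberTheory.EllipticCurves.isIsogenous_quadraticTwist_cmFieldDiscr` they are far
beyond `ring`. This file makes them **decidable by the kernel**: polynomials with integer
coefficients are represented by coefficient lists (constant term first), list arithmetic
(`addL`, `mulL`, …) is proved to commute with the interpretation `ofList : List ℤ → R[X]`, and an
`IsogenyCert` (the ten Weierstrass coefficients and the four coefficient lists, all integers)
with `IsogenyCert.check c = true` — a closed `Bool` computation, discharged by `decide +kernel` —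
yields `IsogenyCert.toFormula : IsogenyFormula W₁ W₂` over any commutative ring of characteristic
`0` whose curves have the certified coefficients, hence `IsogenyCert.isIsogenous : IsIsogenous W₁ W₂`
over a field of characteristic `0` (`isIsogenous_of_isogenyFormula`).

## Main definitions and results

* `Literature.NumberTheory.EllipticCurves.PolyCert.addL`, `negL`, `subL`, `smulL`, `mulL`, `isZeroL`, `coeffL`: coefficient-list
  arithmetic over `ℤ` (computable, structurally recursive, kernel-reducible).
* `Literature.PolyCert.ofList : List ℤ → R[X]` and the interpretation lemmas `ofList_addL`,
  `ofList_mulL`, …, `coeff_ofList`, `natDegree_ofList_le`, `le_natDegree_ofList`.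
* `Literature.NumberTheory.EllipticCurves.PolyCert.IsogenyCert`, `IsogenyCert.check`, `IsogenyCert.toFormula`,
  `IsogenyCert.isIsogenous`.

## References

* [SilvermanAEC2009] J. H. Silverman, *The Arithmetic of Elliptic Curves*, 2nd ed., GTM 106
  (2009), Thm. III.4.8 and Remark III.4.13.3 (the standard form `(U/h², (S y + T)/h³)`).
* Proof by reflection for ring identities: B. Grégoire, A. Mahboubi, *Proving equalities in a
  commutative ring done right in Coq*, TPHOLs 2005 (the design — compute on a free syntax, interpret
  once — is folklore; no result of that paper is used).

## Design choices

* Coefficients are integers and the interpretation casts them into `R`; the Weierstrass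
  coefficients of `W₁, W₂` enter the certificate as integers too, and `toFormula` asks for the
  equalities `W₁ = ⟨a₁, …⟩`, `W₂ = ⟨a₁', …⟩` (closed by `norm_num` on concrete curves). Only
  `CharZero R` is needed (to read `coeffL c.U n ≠ 0` in `R` for the degree condition).
* `smulL 0 p = []`, so that terms of the identities carrying a vanishing Weierstrass coefficient
  are never expanded by the kernel.
* No `native_decide`: certificates are meant to be closed by `decide +kernel` (no axioms beyond the
  three standard ones).
-/

namespace Literature.NumberTheory.EllipticCurves.PolyCert

/-! ### Coefficient-list arithmetic over `ℤ` (constant term first) -/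

/-- Coefficientwise sum of two coefficient lists. [folklore] -/
def addL : List ℤ → List ℤ → List ℤ
  | [], q => q
  | a :: p, [] => a :: p
  | a :: p, b :: q => (a + b) :: addL p q

/-- Coefficientwise negation of a coefficient list. [folklore] -/
def negL (p : List ℤ) : List ℤ :=
  p.map fun a => -a

/-- Difference of two coefficient lists. [folklore] -/
def subL (p q : List ℤ) : List ℤ :=
  addL p (negL q)

/-- Scalar multiple of a coefficient list; the multiple by `0` is the empty list. [folklore] -/
def smulL (a : ℤ) (p : List ℤ) : List ℤ :=
  if a = 0 then [] else p.map fun b => a * b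

/-- Product of two coefficient lists (schoolbook multiplication). [folklore] -/
def mulL : List ℤ → List ℤ → List ℤ
  | [], _ => []
  | a :: p, q => addL (smulL a q) (0 :: mulL p q)

/-- All coefficients of the list vanish. [folklore] -/
def isZeroL (p : List ℤ) : Bool :=
  p.all fun a => a == 0

/-- The `n`-th entry of a coefficient list, `0` beyond its length. [folklore] -/
def coeffL : List ℤ → ℕ → ℤ
  | [], _ => 0
  | a :: _, 0 => a
  | _ :: p, n + 1 => coeffL p n

/-- Beyond the length all entries are `0`. [folklore] -/
theorem coeffL_eq_zero_of_le : ∀ (p : List ℤ) (n : ℕ), p.length ≤ n → coeffL p n = 0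
  | [], _, _ => rfl
  | _ :: _, 0, h => absurd h (by simp)
  | _ :: p, n + 1, h => coeffL_eq_zero_of_le p n (by simpa using h)

/-- `isZeroL` on a `cons`. [folklore] -/
theorem isZeroL_cons (a : ℤ) (p : List ℤ) : isZeroL (a :: p) = (a == 0 && isZeroL p) := rfl

end Literature.NumberTheory.EllipticCurves.PolyCert

/-! ### Interpretation in `R[X]` -/

noncomputable section

open Polynomial

namespace Literature.NumberTheory.EllipticCurves.PolyCert

variable {R : Type*} [CommRing R]

/-- The polynomial with the given integer coefficients, constant term first:
`ofList [c₀, c₁, …, cₙ] = c₀ + c₁ X + ⋯ + cₙ Xⁿ ∈ R[X]`. [folklore] -/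
def ofList : List ℤ → R[X]
  | [] => 0
  | a :: p => C (a : R) + X * ofList p

/-- `ofList [] = 0`. [folklore] -/
@[simp] theorem ofList_nil : (ofList [] : R[X]) = 0 := rfl

/-- `ofList (a :: p) = a + X · ofList p`. [folklore] -/
@[simp] theorem ofList_cons (a : ℤ) (p : List ℤ) :
    (ofList (a :: p) : R[X]) = C (a : R) + X * ofList p := rfl

/-- `ofList` turns `addL` into `+`. [folklore] -/
theorem ofList_addL : ∀ p q : List ℤ, (ofList (addL p q) : R[X]) = ofList p + ofList q
  | [], q => by simp [addL]
  | a :: p, [] => by simp [addL]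
  | a :: p, b :: q => by
      rw [addL, ofList_cons, ofList_cons, ofList_cons, ofList_addL p q, Int.cast_add, map_add]
      ring

/-- `ofList` turns `List.map (a * ·)` into multiplication by the constant `a`. [folklore] -/
theorem ofList_map_mul (a : ℤ) :
    ∀ p : List ℤ, (ofList (p.map fun b => a * b) : R[X]) = C (a : R) * ofList p
  | [] => by simp
  | b :: p => by
      rw [List.map_cons, ofList_cons, ofList_cons, ofList_map_mul a p, Int.cast_mul, map_mul]
      ring

/-- `ofList` turns `smulL a` into multiplication by the constant `a`. [folklore] -/
theorem ofList_smulL (a : ℤ) (p : List ℤ) : (ofList (smulL a p) : R[X]) = C (a : R) * ofList p := by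
  unfold smulL
  split_ifs with ha
  · simp [ha]
  · exact ofList_map_mul a p

/-- `ofList` turns `negL` into negation. [folklore] -/
theorem ofList_negL (p : List ℤ) : (ofList (negL p) : R[X]) = -ofList p := by
  induction p with
  | nil => simp [negL]
  | cons a p ih =>
      simp only [negL, List.map_cons, ofList_cons] at ih ⊢
      rw [ih, Int.cast_neg, map_neg]
      ring

/-- `ofList` turns `subL` into subtraction. [folklore] -/
theorem ofList_subL (p q : List ℤ) : (ofList (subL p q) : R[X]) = ofList p - ofList q := by
  rw [subL, ofList_addL, ofList_negL, sub_eq_add_neg]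

/-- `ofList` turns `mulL` into multiplication. [folklore] -/
theorem ofList_mulL : ∀ p q : List ℤ, (ofList (mulL p q) : R[X]) = ofList p * ofList q
  | [], q => by simp [mulL]
  | a :: p, q => by
      rw [mulL, ofList_addL, ofList_smulL, ofList_cons, ofList_cons, ofList_mulL p q, Int.cast_zero,
        map_zero, zero_add]
      ring

/-- A list of zeros interprets to the zero polynomial. [folklore] -/
theorem ofList_eq_zero_of_isZeroL : ∀ p : List ℤ, isZeroL p = true → (ofList p : R[X]) = 0
  | [], _ => rfl
  | a :: p, h => by
      rw [isZeroL_cons, Bool.and_eq_true, beq_iff_eq] at h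
      rw [ofList_cons, h.1, ofList_eq_zero_of_isZeroL p h.2, Int.cast_zero, map_zero, mul_zero,
        add_zero]

/-- **The reflection step**: two coefficient lists whose difference is a list of zeros interpret
to the same polynomial. [folklore] -/
theorem ofList_eq_of_isZeroL_subL (p q : List ℤ) (h : isZeroL (subL p q) = true) :
    (ofList p : R[X]) = ofList q :=
  sub_eq_zero.mp (by rw [← ofList_subL]; exact ofList_eq_zero_of_isZeroL _ h)

/-- The coefficients of `ofList p` are the (cast) entries of `p`. [folklore] -/
theorem coeff_ofList : ∀ (p : List ℤ) (n : ℕ), (ofList p : R[X]).coeff n = (coeffL p n : R)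
  | [], n => by simp [coeffL]
  | a :: p, 0 => by simp [coeffL]
  | a :: p, n + 1 => by
      rw [ofList_cons, coeff_add, coeff_C_succ, coeff_X_mul, coeff_ofList p n, zero_add, coeffL]

/-- `deg (ofList p) ≤ |p| - 1`. [folklore] -/
theorem natDegree_ofList_le (p : List ℤ) : (ofList p : R[X]).natDegree ≤ p.length - 1 := by
  refine natDegree_le_iff_degree_le.mpr ((degree_le_iff_coeff_zero _ _).mpr fun m hm => ?_)
  have hm' : p.length - 1 < m := WithBot.coe_lt_coe.mp hm
  rw [coeff_ofList, coeffL_eq_zero_of_le p m (by omega), Int.cast_zero]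

variable [CharZero R]

/-- A nonzero entry bounds the degree from below (characteristic `0`). [folklore] -/
theorem le_natDegree_ofList (p : List ℤ) (n : ℕ) (h : coeffL p n ≠ 0) :
    n ≤ (ofList p : R[X]).natDegree :=
  le_natDegree_of_ne_zero (by rw [coeff_ofList]; exact_mod_cast h)

/-- A list with a nonzero entry interprets to a nonzero polynomial (characteristic `0`). [folklore] -/
theorem ofList_ne_zero (p : List ℤ) (n : ℕ) (h : coeffL p n ≠ 0) : (ofList p : R[X]) ≠ 0 := by
  intro h0
  have h1 := coeff_ofList (R := R) p n
  rw [h0, coeff_zero] at h1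
  exact h (by exact_mod_cast h1.symm)

/-! ### Certificates for `IsogenyFormula` -/

/-- **A certificate for an explicit isogeny formula.** The ten Weierstrass coefficients of the
domain `W₁ = [a₁, a₂, a₃, a₄, a₆]` and of the codomain `W₂ = [a₁', a₂', a₃', a₄', a₆']`
(integers) and the coefficient lists (constant term first, integers) of the four polynomials
`U, h, S, T` of a rational map `(x, y) ↦ (U(x)/h(x)², (S(x)·y + T(x))/h(x)³)` in the standard form
of Silverman, *AEC*, Remark III.4.13.3. Whether it is an isogeny formula is decided by
`IsogenyCert.check`. [cite: SilvermanAEC2009, Thm. III.4.8 and Remark III.4.13.3] -/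
structure IsogenyCert where
  /-- `a₁` of the domain curve `W₁`. -/
  a₁ : ℤ
  /-- `a₂` of the domain curve `W₁`. -/
  a₂ : ℤ
  /-- `a₃` of the domain curve `W₁`. -/
  a₃ : ℤ
  /-- `a₄` of the domain curve `W₁`. -/
  a₄ : ℤ
  /-- `a₆` of the domain curve `W₁`. -/
  a₆ : ℤ
  /-- `a₁` of the codomain curve `W₂`. -/
  a₁' : ℤ
  /-- `a₂` of the codomain curve `W₂`. -/
  a₂' : ℤ
  /-- `a₃` of the codomain curve `W₂`. -/
  a₃' : ℤ
  /-- `a₄` of the codomain curve `W₂`. -/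
  a₄' : ℤ
  /-- `a₆` of the codomain curve `W₂`. -/
  a₆' : ℤ
  /-- Coefficients of the numerator `U` of the `x`-coordinate map `U/h²`. -/
  U : List ℤ
  /-- Coefficients of the denominator (kernel) polynomial `h`. -/
  h : List ℤ
  /-- Coefficients of `S` in the `y`-coordinate map `(S y + T)/h³`. -/
  S : List ℤ
  /-- Coefficients of `T` in the `y`-coordinate map `(S y + T)/h³`. -/
  T : List ℤ

namespace IsogenyCert

variable (c : IsogenyCert)

/-- The coefficient list of `2 S T + (a₁' U h + a₃' h³) S - S² (a₁ X + a₃)` (the difference of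
the two sides of `IsogenyFormula.identity₁`). [folklore] -/
def id₁L : List ℤ :=
  subL (addL (smulL 2 (mulL c.S c.T))
      (mulL (addL (smulL c.a₁' (mulL c.U c.h)) (smulL c.a₃' (mulL c.h (mulL c.h c.h)))) c.S))
    (mulL (mulL c.S c.S) [c.a₃, c.a₁])

/-- The coefficient list of
`T² + (a₁' U h + a₃' h³) T - (U³ + a₂' U² h² + a₄' U h⁴ + a₆' h⁶) + S² (X³ + a₂ X² + a₄ X + a₆)`
(the difference of the two sides of `IsogenyFormula.identity₀`). [folklore] -/
def id₀L : List ℤ :=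
  let h2 := mulL c.h c.h
  let h3 := mulL h2 c.h
  let h4 := mulL h2 h2
  let h6 := mulL h4 h2
  let U2 := mulL c.U c.U
  addL (subL (addL (mulL c.T c.T) (mulL (addL (smulL c.a₁' (mulL c.U c.h)) (smulL c.a₃' h3)) c.T))
      (addL (addL (mulL U2 c.U) (smulL c.a₂' (mulL U2 h2)))
        (addL (smulL c.a₄' (mulL c.U h4)) (smulL c.a₆' h6))))
    (mulL (mulL c.S c.S) [c.a₆, c.a₄, c.a₂, 1])

/-- **The certificate check** (a closed `Bool`, meant for `decide +kernel`): both identities hold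
coefficientwise, `2 (|h| - 1) < |U| - 1`, and the last listed coefficients of `U` and `h` are
nonzero (so `deg h² ≤ 2(|h| - 1) < |U| - 1 = deg U` and `h ≠ 0`). [folklore] -/
def check : Bool :=
  isZeroL c.id₁L && isZeroL c.id₀L && decide (2 * (c.h.length - 1) < c.U.length - 1) &&
    !(coeffL c.U (c.U.length - 1) == 0) && !(coeffL c.h (c.h.length - 1) == 0)

variable {c}

/-- Unpacking a successful check. [folklore] -/
theorem check_spec (hc : c.check = true) :
    isZeroL c.id₁L = true ∧ isZeroL c.id₀L = true ∧ 2 * (c.h.length - 1) < c.U.length - 1 ∧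
      coeffL c.U (c.U.length - 1) ≠ 0 ∧ coeffL c.h (c.h.length - 1) ≠ 0 := by
  simp only [check, Bool.and_eq_true, decide_eq_true_eq, Bool.not_eq_true', beq_eq_false_iff_ne,
    ne_eq] at hc
  exact ⟨hc.1.1.1.1, hc.1.1.1.2, hc.1.1.2, hc.1.2, hc.2⟩

/-- The degree condition `deg h² < deg U` from a successful check (characteristic `0`). [folklore] -/
theorem natDegree_lt (hc : c.check = true) :
    ((ofList c.h : R[X]) ^ 2).natDegree < (ofList c.U : R[X]).natDegree := by
  obtain ⟨-, -, hlt, hU, -⟩ := check_spec hc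
  calc ((ofList c.h : R[X]) ^ 2).natDegree ≤ 2 * (ofList c.h : R[X]).natDegree := natDegree_pow_le
    _ ≤ 2 * (c.h.length - 1) := Nat.mul_le_mul_left 2 (natDegree_ofList_le c.h)
    _ < c.U.length - 1 := hlt
    _ ≤ (ofList c.U : R[X]).natDegree := le_natDegree_ofList c.U _ hU

/-- **The isogeny formula attached to a checked certificate**, between any two Weierstrass curves
over a commutative ring of characteristic `0` with the certified coefficients: the identities of
`IsogenyFormula` are read off from `isZeroL c.id₁L`, `isZeroL c.id₀L` through the interpretation
lemmas `ofList_addL`, `ofList_mulL`, …, and the degree condition from `natDegree_lt`.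
[cite: SilvermanAEC2009, Thm. III.4.8 and Remark III.4.13.3] -/
def toFormula (hc : c.check = true) (W₁ W₂ : WeierstrassCurve R)
    (h₁ : W₁ = ⟨c.a₁, c.a₂, c.a₃, c.a₄, c.a₆⟩) (h₂ : W₂ = ⟨c.a₁', c.a₂', c.a₃', c.a₄', c.a₆'⟩) :
    WeierstrassCurve.IsogenyFormula W₁ W₂ where
  U := ofList c.U
  h := ofList c.h
  S := ofList c.S
  T := ofList c.T
  identity₁ := by
    subst h₁ h₂
    have H := ofList_eq_zero_of_isZeroL (R := R) _ (check_spec hc).1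
    simp only [id₁L, ofList_subL, ofList_addL, ofList_mulL, ofList_smulL, ofList_cons, ofList_nil,
      Int.cast_ofNat, map_ofNat, mul_zero, add_zero] at H
    linear_combination H
  identity₀ := by
    subst h₁ h₂
    have H := ofList_eq_zero_of_isZeroL (R := R) _ (check_spec hc).2.1
    simp only [id₀L, ofList_subL, ofList_addL, ofList_mulL, ofList_smulL, ofList_cons, ofList_nil,
      Int.cast_one, map_one, mul_zero, add_zero] at H
    linear_combination H
  h_ne_zero := ofList_ne_zero c.h _ (check_spec hc).2.2.2.2
  natDegree_lt := natDegree_lt hc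

/-- **Isogenous by certificate.** Two elliptic curves over a field of characteristic `0` whose
Weierstrass coefficients are those of a checked certificate are isogenous over that field
(`isIsogenous_of_isogenyFormula`, Silverman *AEC* III.4.8). [cite: SilvermanAEC2009, Thm. III.4.8] -/
theorem isIsogenous {K : Type*} [Field K] [CharZero K] {W₁ W₂ : WeierstrassCurve K}
    [W₁.IsElliptic] [W₂.IsElliptic] (c : IsogenyCert) (hc : c.check = true)
    (h₁ : W₁ = ⟨c.a₁, c.a₂, c.a₃, c.a₄, c.a₆⟩) (h₂ : W₂ = ⟨c.a₁', c.a₂', c.a₃', c.a₄', c.a₆'⟩) :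
    WeierstrassCurve.IsIsogenous W₁ W₂ :=
  WeierstrassCurve.IsogenyFormula.isIsogenous_of_isogenyFormula (c.toFormula hc W₁ W₂ h₁ h₂)

end IsogenyCert

end Literature.NumberTheory.EllipticCurves.PolyCert

end
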